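import Literature.Probability.LatticeModels.CriticalBlockMoments

/-!
# The Binder numerator of a weighted critical block spin (tools for the smeared `U₄` criterion)

Route LeeYangGap, crux stmt-CriticalPhenomena-4945 (`NearCriticalLeeYangGap` ⟺ `limsup_L g_L > 0` for
the critical block Binder cumulant `g_L = (3⟨M_L²⟩² - ⟨M_L⁴⟩)/⟨M_L²⟩²` on `ℤ³`). This file supplies the
three model-independent tools used to identify the survey target
`Literature.Barriers.CriticalPhenomena.HasNonGaussianCriticalSmearing d` (Aizenman–Duminil-Copin 2021,
Prop. 1.4: smeared non-Gaussianity) with a Binder floor along a subsequence: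

1. `integral_exp_le_of_gaussian_domination` — for a bounded symmetric random variable whose even
   moments are dominated by the Gaussian ones and whose fourth moment has a deficit `D`,
   `E[e^{zX}] ≤ e^{z²E[X²]/2} - D z⁴/24` (the moment series, termwise);
2. `exists_tent_testFunction` — a continuous `f` with `1_{[-1,1]^d} ≤ f ≤ 1_{[-2,2]^d}`;
3. `three_mul_sq_sub_fourth_weighted`, `binderNumerator_mono` — for `S = ∑_{x∈B} w_x σ_x` in the
   critical state, `3⟨S²⟩² - ⟨S⁴⟩ = -∑ w_a w_b w_c w_e U₄(a,b,c,e)`, hence (Lebowitz `U₄ ≤ 0`) it is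
   monotone in weights `0 ≤ w ≤ 1`: `3⟨M_A²⟩² - ⟨M_A⁴⟩ ≤ 3⟨S²⟩² - ⟨S⁴⟩` when `w = 1` on `A ⊆ B`.

References: M. Aizenman, CDM 2020 (arXiv:2112.04248) §7, (7.1)–(7.4) and Prop. 7.1–7.2;
J. L. Lebowitz, CMP 35 (1974) 87–92; C. M. Newman, CMP 41 (1975) 1–9.
-/

noncomputable section

namespace Summit.CriticalPhenomena.Ising3DConformalLimit.LeeYangGapSmearedNonGaussianity

open MeasureTheory Filter Topology Finset
open scoped Nat BigOperators
open Literature.Probability.LatticeModels Literature.Probability.Percolation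
open Literature.Barriers.CriticalPhenomena

/-! ### 1. A sub-Gaussian fourth moment depresses the exponential moment (pure probability) -/

/-- **Moment series with a fourth-moment deficit.** Let `X` be a bounded random variable whose odd
moments vanish and whose even moments are dominated by the Gaussian ones,
`E[X^{2n}] ≤ (2n)!/(2ⁿn!) E[X²]ⁿ`, and suppose `E[X⁴] ≤ 3E[X²]² - D`. Then for every real `z`,
`E[exp(zX)] ≤ exp(z²E[X²]/2) - D z⁴/24` (termwise comparison of the two power series).
[cite: AizenmanCDM2020, §7 Prop. 7.1 (Newman's Gaussian bounds and the U₄ criterion)] -/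
theorem integral_exp_le_of_gaussian_domination {Ω : Type*} [MeasurableSpace Ω] {μ : Measure Ω}
    [IsFiniteMeasure μ] {X : Ω → ℝ} (hXm : Measurable X) {K : ℝ} (hXb : ∀ ω, |X ω| ≤ K) {D : ℝ}
    (hdom : ∀ n : ℕ, ∫ ω, X ω ^ (2 * n) ∂μ ≤
      ((2 * n)! : ℝ) / (2 ^ n * n !) * (∫ ω, X ω ^ 2 ∂μ) ^ n)
    (h4 : ∫ ω, X ω ^ 4 ∂μ ≤ 3 * (∫ ω, X ω ^ 2 ∂μ) ^ 2 - D)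
    (hodd : ∀ n : ℕ, ∫ ω, X ω ^ (2 * n + 1) ∂μ = 0) (z : ℝ) :
    ∫ ω, Real.exp (z * X ω) ∂μ ≤ Real.exp (z ^ 2 / 2 * ∫ ω, X ω ^ 2 ∂μ) - D * z ^ 4 / 24 := by
  set V : ℝ := ∫ ω, X ω ^ 2 ∂μ with hV
  set m : ℕ → ℝ := fun k => ∫ ω, X ω ^ k ∂μ with hm
  have h1 : HasSum (fun k : ℕ => z ^ k / k ! * m k) (∫ ω, Real.exp (z * X ω) ∂μ) :=
    hasSum_integral_pow_div_factorial μ hXm hXb z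
  have h2 : HasSum (fun n : ℕ => z ^ (2 * n) / (2 * n)! * m (2 * n))
      (∫ ω, Real.exp (z * X ω) ∂μ) := by
    have key := (Function.Injective.hasSum_iff (mul_right_injective₀ (two_ne_zero' ℕ))
      (f := fun k : ℕ => z ^ k / k ! * m k) (a := ∫ ω, Real.exp (z * X ω) ∂μ) ?_).mpr h1
    · simpa only [Function.comp_def] using key
    · intro k hk
      rcases Nat.even_or_odd k with ⟨j, hj⟩ | ⟨j, hj⟩
      · exact absurd ⟨j, show 2 * j = k by omega⟩ hk
      · subst hj
        simp only [hm, hodd j, mul_zero]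
  have hterm : ∀ n : ℕ, z ^ (2 * n) / (2 * n)! * (((2 * n)! : ℝ) / (2 ^ n * n !) * V ^ n)
      = (z ^ 2 / 2 * V) ^ n / n ! := fun n => by
    have hn : ((2 * n)! : ℝ) ≠ 0 := by positivity
    rw [pow_mul, show z ^ 2 / 2 * V = z ^ 2 * V / 2 by ring, div_pow, mul_pow]
    field_simp
  have h3 : HasSum (fun n : ℕ => z ^ (2 * n) / (2 * n)! * (((2 * n)! : ℝ) / (2 ^ n * n !) * V ^ n))
      (Real.exp (z ^ 2 / 2 * V)) := by
    simp_rw [hterm]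
    rw [Real.exp_eq_exp_ℝ]
    exact NormedSpace.expSeries_div_hasSum_exp _
  have h5 : HasSum (fun n : ℕ => if n = 2 then D * z ^ 4 / 24 else 0) (D * z ^ 4 / 24) :=
    hasSum_ite_eq 2 _
  have h6 := h3.sub h5
  refine hasSum_le (fun n => ?_) h2 h6
  have hz2 : 0 ≤ z ^ (2 * n) := by rw [pow_mul]; positivity
  have hcoef : 0 ≤ z ^ (2 * n) / (2 * n)! := div_nonneg hz2 (by positivity)
  by_cases hn : n = 2
  · subst hn
    simp only [if_true]
    have e1 : z ^ (2 * 2) / (2 * 2)! = z ^ 4 / 24 := by norm_num [Nat.factorial]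
    have e2 : ((2 * 2)! : ℝ) / (2 ^ 2 * 2 !) = 3 := by norm_num [Nat.factorial]
    rw [e1, e2]
    have hz4 : 0 ≤ z ^ 4 := by positivity
    have := mul_le_mul_of_nonneg_left h4 (div_nonneg hz4 (by norm_num : (0 : ℝ) ≤ 24))
    have e3 : m (2 * 2) = ∫ ω, X ω ^ 4 ∂μ := rfl
    rw [e3]
    linarith
  · simp only [hn, if_false, sub_zero]
    exact mul_le_mul_of_nonneg_left (hdom n) hcoef

/-! ### 2. The tent test function -/

/-- A continuous test function on `ℝ^d` with `1_{[-1,1]^d} ≤ f ≤ 1_{[-2,2]^d}`: the product of the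
tents `max(0, min(1, 2 - |vᵢ|))`. [folklore] -/
theorem exists_tent_testFunction (d : ℕ) :
    ∃ f : EuclideanSpace ℝ (Fin d) → ℝ, Continuous f ∧ (∀ v, 0 ≤ f v) ∧ (∀ v, f v ≤ 1) ∧
      (∀ v, f v ≠ 0 → ∀ i, |v i| ≤ 2) ∧ (∀ v, (∀ i, |v i| ≤ 1) → f v = 1) := by
  refine ⟨fun v => ∏ i, max 0 (min 1 (2 - |v i|)), ?_, ?_, ?_, ?_, ?_⟩
  · refine continuous_finsetProd _ fun i _ => ?_
    have hi : Continuous fun v : EuclideanSpace ℝ (Fin d) => v i := (EuclideanSpace.proj i).continuous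
    exact continuous_const.max (continuous_const.min (continuous_const.sub hi.abs))
  · exact fun v => Finset.prod_nonneg fun i _ => le_max_left _ _
  · exact fun v => Finset.prod_le_one (fun i _ => le_max_left _ _)
      fun i _ => max_le zero_le_one (min_le_left _ _)
  · intro v hv i
    by_contra hi
    refine hv (Finset.prod_eq_zero (Finset.mem_univ i) ?_)
    exact max_eq_left (le_trans (min_le_right _ _) (by linarith [not_le.mp hi]))
  · intro v hv
    refine Finset.prod_eq_one fun i _ => ?_
    rw [min_eq_left (by linarith [hv i]), max_eq_right zero_le_one]

/-! ### 3. The Binder numerator of a weighted block spin and Lebowitz monotonicity -/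

variable {d : ℕ}

/-- The lattice Ursell function of the critical state, written with `criticalCorr` as in
`three_mul_sq_sub_fourth_eq_neg_sum_ursellFour`: `U₄ ≤ 0` (Lebowitz). [cite: Lebowitz1974, Theorem, eq. (2.5b)] -/
theorem criticalUrsellFour_nonpos' (hd : 3 ≤ d) (a b c e : Site d) :
    criticalCorr d 4 ![a, b, c, e] -
        (criticalCorr d 2 ![a, b] * criticalCorr d 2 ![c, e] +
          criticalCorr d 2 ![a, c] * criticalCorr d 2 ![b, e] +
          criticalCorr d 2 ![a, e] * criticalCorr d 2 ![b, c]) ≤ 0 := by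
  simpa using criticalUrsellFour_nonpos hd ![a, b, c, e]

/-- **Moments of a weighted block spin in the critical state.** For a finite measure `μ` with the
plus correlations at `β_c`, weights `w` and a finite `B`, with `S = ∑_{x ∈ B} w_x σ_x`:
`3⟨S²⟩² - ⟨S⁴⟩ = -∑_{a,b,c,e ∈ B} w_a w_b w_c w_e U₄(a,b,c,e)` (Aizenman, CDM 2020, §7
(7.1)–(7.4), smeared). [cite: AizenmanCDM2020, §7 eqs. (7.1)–(7.4)] -/
theorem three_mul_sq_sub_fourth_weighted {μ : Measure (SpinConfig (Site d))} [IsFiniteMeasure μ]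
    (hμ : ∀ A : Finset (Site d), spinCorr μ A = plusCorr d (criticalBeta d) 0 A)
    (B : Finset (Site d)) (w : Site d → ℝ) :
    3 * (∫ σ, (∑ x ∈ B, w x * spinAt x σ) ^ 2 ∂μ) ^ 2 - ∫ σ, (∑ x ∈ B, w x * spinAt x σ) ^ 4 ∂μ =
      -∑ a ∈ B, ∑ b ∈ B, ∑ c ∈ B, ∑ e ∈ B, w a * w b * w c * w e *
        (criticalCorr d 4 ![a, b, c, e] -
          (criticalCorr d 2 ![a, b] * criticalCorr d 2 ![c, e] +
            criticalCorr d 2 ![a, c] * criticalCorr d 2 ![b, e] +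
            criticalCorr d 2 ![a, e] * criticalCorr d 2 ![b, c])) := by
  classical
  have hint : ∀ (n : ℕ) (y : Fin n → Site d), Integrable (spinMonomial y) μ := fun n y =>
    Integrable.of_bound (measurable_spinMonomial y).aestronglyMeasurable 1
      (Eventually.of_forall fun s => by
        rw [Real.norm_eq_abs]
        simp [spinMonomial, Finset.abs_prod])
  -- second moment
  have h2 : ∫ σ, (∑ x ∈ B, w x * spinAt x σ) ^ 2 ∂μ =
      ∑ a ∈ B, ∑ b ∈ B, w a * w b * criticalCorr d 2 ![a, b] := by
    have hpt : ∀ σ : SpinConfig (Site d), (∑ x ∈ B, w x * spinAt x σ) ^ 2 =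
        ∑ a ∈ B, ∑ b ∈ B, w a * w b * spinMonomial ![a, b] σ := by
      intro σ
      rw [sq, Finset.sum_mul_sum]
      refine Finset.sum_congr rfl fun a _ => Finset.sum_congr rfl fun b _ => ?_
      simp [spinMonomial, Fin.prod_univ_two]
      ring
    simp_rw [hpt]
    rw [integral_finsetSum _ fun a _ => integrable_finsetSum _ fun b _ => (hint 2 ![a, b]).const_mul _]
    refine Finset.sum_congr rfl fun a _ => ?_
    rw [integral_finsetSum _ fun b _ => (hint 2 ![a, b]).const_mul _]
    refine Finset.sum_congr rfl fun b _ => ?_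
    rw [integral_const_mul, criticalCorr_eq_integral_spinMonomial hμ ![a, b]]
  -- fourth moment
  have h4 : ∫ σ, (∑ x ∈ B, w x * spinAt x σ) ^ 4 ∂μ =
      ∑ a ∈ B, ∑ b ∈ B, ∑ c ∈ B, ∑ e ∈ B, w a * w b * w c * w e *
        criticalCorr d 4 ![a, b, c, e] := by
    have hpt : ∀ σ : SpinConfig (Site d), (∑ x ∈ B, w x * spinAt x σ) ^ 4 =
        ∑ a ∈ B, ∑ b ∈ B, ∑ c ∈ B, ∑ e ∈ B, w a * w b * w c * w e *
          spinMonomial ![a, b, c, e] σ := by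
      intro σ
      rw [sum_pow_four_eq_sum]
      refine Finset.sum_congr rfl fun a _ => Finset.sum_congr rfl fun b _ =>
        Finset.sum_congr rfl fun c _ => Finset.sum_congr rfl fun e _ => ?_
      simp [spinMonomial, Fin.prod_univ_four]
      ring
    simp_rw [hpt]
    rw [integral_finsetSum _ fun a _ => integrable_finsetSum _ fun b _ =>
      integrable_finsetSum _ fun c _ => integrable_finsetSum _ fun e _ =>
        (hint 4 ![a, b, c, e]).const_mul _]
    refine Finset.sum_congr rfl fun a _ => ?_
    rw [integral_finsetSum _ fun b _ => integrable_finsetSum _ fun c _ =>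
      integrable_finsetSum _ fun e _ => (hint 4 ![a, b, c, e]).const_mul _]
    refine Finset.sum_congr rfl fun b _ => ?_
    rw [integral_finsetSum _ fun c _ => integrable_finsetSum _ fun e _ =>
      (hint 4 ![a, b, c, e]).const_mul _]
    refine Finset.sum_congr rfl fun c _ => ?_
    rw [integral_finsetSum _ fun e _ => (hint 4 ![a, b, c, e]).const_mul _]
    refine Finset.sum_congr rfl fun e _ => ?_
    rw [integral_const_mul, criticalCorr_eq_integral_spinMonomial hμ ![a, b, c, e]]
  -- the three pairing sums are squares of the second moment
  set C2 : Site d → Site d → ℝ := fun a b => w a * w b * criticalCorr d 2 ![a, b] with hC2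
  have e1 : ∑ a ∈ B, ∑ b ∈ B, ∑ c ∈ B, ∑ e ∈ B, w a * w b * w c * w e *
      (criticalCorr d 2 ![a, b] * criticalCorr d 2 ![c, e]) =
      (∑ a ∈ B, ∑ b ∈ B, C2 a b) * (∑ a ∈ B, ∑ b ∈ B, C2 a b) := by
    rw [← sum_sum_sum_sum_mul_pair01]
    exact Finset.sum_congr rfl fun a _ => Finset.sum_congr rfl fun b _ =>
      Finset.sum_congr rfl fun c _ => Finset.sum_congr rfl fun e _ => by simp only [hC2]; ring
  have e2 : ∑ a ∈ B, ∑ b ∈ B, ∑ c ∈ B, ∑ e ∈ B, w a * w b * w c * w e *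
      (criticalCorr d 2 ![a, c] * criticalCorr d 2 ![b, e]) =
      (∑ a ∈ B, ∑ b ∈ B, C2 a b) * (∑ a ∈ B, ∑ b ∈ B, C2 a b) := by
    rw [← sum_sum_sum_sum_mul_pair02]
    exact Finset.sum_congr rfl fun a _ => Finset.sum_congr rfl fun b _ =>
      Finset.sum_congr rfl fun c _ => Finset.sum_congr rfl fun e _ => by simp only [hC2]; ring
  have e3 : ∑ a ∈ B, ∑ b ∈ B, ∑ c ∈ B, ∑ e ∈ B, w a * w b * w c * w e *
      (criticalCorr d 2 ![a, e] * criticalCorr d 2 ![b, c]) =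
      (∑ a ∈ B, ∑ b ∈ B, C2 a b) * (∑ a ∈ B, ∑ b ∈ B, C2 a b) := by
    rw [← sum_sum_sum_sum_mul_pair03]
    exact Finset.sum_congr rfl fun a _ => Finset.sum_congr rfl fun b _ =>
      Finset.sum_congr rfl fun c _ => Finset.sum_congr rfl fun e _ => by simp only [hC2]; ring
  have hsplit : ∑ a ∈ B, ∑ b ∈ B, ∑ c ∈ B, ∑ e ∈ B, w a * w b * w c * w e *
        (criticalCorr d 4 ![a, b, c, e] -
          (criticalCorr d 2 ![a, b] * criticalCorr d 2 ![c, e] +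
            criticalCorr d 2 ![a, c] * criticalCorr d 2 ![b, e] +
            criticalCorr d 2 ![a, e] * criticalCorr d 2 ![b, c])) =
      (∑ a ∈ B, ∑ b ∈ B, ∑ c ∈ B, ∑ e ∈ B, w a * w b * w c * w e *
        criticalCorr d 4 ![a, b, c, e]) -
      (∑ a ∈ B, ∑ b ∈ B, ∑ c ∈ B, ∑ e ∈ B, w a * w b * w c * w e *
        (criticalCorr d 2 ![a, b] * criticalCorr d 2 ![c, e])) -
      (∑ a ∈ B, ∑ b ∈ B, ∑ c ∈ B, ∑ e ∈ B, w a * w b * w c * w e *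
        (criticalCorr d 2 ![a, c] * criticalCorr d 2 ![b, e])) -
      (∑ a ∈ B, ∑ b ∈ B, ∑ c ∈ B, ∑ e ∈ B, w a * w b * w c * w e *
        (criticalCorr d 2 ![a, e] * criticalCorr d 2 ![b, c])) := by
    simp only [mul_sub, mul_add, Finset.sum_sub_distrib, Finset.sum_add_distrib]
    ring
  have h2' : ∫ σ, (∑ x ∈ B, w x * spinAt x σ) ^ 2 ∂μ = ∑ a ∈ B, ∑ b ∈ B, C2 a b := h2
  rw [hsplit, e1, e2, e3, h4, h2']
  ring

/-- **Lebowitz monotonicity of the Binder numerator in the weights.** For weights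
`0 ≤ w ≤ 1` on `B` equal to `1` on `A ⊆ B`:
`3⟨M_A²⟩² - ⟨M_A⁴⟩ ≤ 3⟨S²⟩² - ⟨S⁴⟩` for `M_A = ∑_{x∈A} σ_x`, `S = ∑_{x ∈ B} w_x σ_x`
(each term `-w_a w_b w_c w_e U₄(a,b,c,e)` is non-negative by Lebowitz' inequality).
[cite: Lebowitz1974, Theorem, eq. (2.5b)] [cite: AizenmanCDM2020, §7 eqs. (7.1)–(7.4)] -/
theorem binderNumerator_mono (hd : 3 ≤ d) {μ : Measure (SpinConfig (Site d))} [IsFiniteMeasure μ]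
    (hμ : ∀ A : Finset (Site d), spinCorr μ A = plusCorr d (criticalBeta d) 0 A)
    {A B : Finset (Site d)} (hAB : A ⊆ B) {w : Site d → ℝ} (hw0 : ∀ x, 0 ≤ w x)
    (hwA : ∀ x ∈ A, w x = 1) :
    3 * (∫ σ, (∑ x ∈ A, spinAt x σ) ^ 2 ∂μ) ^ 2 - ∫ σ, (∑ x ∈ A, spinAt x σ) ^ 4 ∂μ ≤
      3 * (∫ σ, (∑ x ∈ B, w x * spinAt x σ) ^ 2 ∂μ) ^ 2 -
        ∫ σ, (∑ x ∈ B, w x * spinAt x σ) ^ 4 ∂μ := by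
  set U : Site d → Site d → Site d → Site d → ℝ := fun a b c e =>
    criticalCorr d 4 ![a, b, c, e] -
      (criticalCorr d 2 ![a, b] * criticalCorr d 2 ![c, e] +
        criticalCorr d 2 ![a, c] * criticalCorr d 2 ![b, e] +
        criticalCorr d 2 ![a, e] * criticalCorr d 2 ![b, c]) with hU
  have hU0 : ∀ a b c e, 0 ≤ -U a b c e := fun a b c e =>
    neg_nonneg.mpr (criticalUrsellFour_nonpos' hd a b c e)
  have hA : 3 * (∫ σ, (∑ x ∈ A, spinAt x σ) ^ 2 ∂μ) ^ 2 - ∫ σ, (∑ x ∈ A, spinAt x σ) ^ 4 ∂μ =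
      ∑ a ∈ A, ∑ b ∈ A, ∑ c ∈ A, ∑ e ∈ A, w a * w b * w c * w e * (-U a b c e) := by
    have key := three_mul_sq_sub_fourth_weighted hμ A (fun _ => (1 : ℝ))
    simp only [one_mul] at key
    rw [key, ← Finset.sum_neg_distrib]
    refine Finset.sum_congr rfl fun a ha => ?_
    rw [← Finset.sum_neg_distrib]
    refine Finset.sum_congr rfl fun b hb => ?_
    rw [← Finset.sum_neg_distrib]
    refine Finset.sum_congr rfl fun c hc => ?_
    rw [← Finset.sum_neg_distrib]
    refine Finset.sum_congr rfl fun e he => ?_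
    rw [hwA a ha, hwA b hb, hwA c hc, hwA e he]
    simp [hU]
  have hB : 3 * (∫ σ, (∑ x ∈ B, w x * spinAt x σ) ^ 2 ∂μ) ^ 2 -
      ∫ σ, (∑ x ∈ B, w x * spinAt x σ) ^ 4 ∂μ =
      ∑ a ∈ B, ∑ b ∈ B, ∑ c ∈ B, ∑ e ∈ B, w a * w b * w c * w e * (-U a b c e) := by
    rw [three_mul_sq_sub_fourth_weighted hμ B w, ← Finset.sum_neg_distrib]
    refine Finset.sum_congr rfl fun a _ => ?_
    rw [← Finset.sum_neg_distrib]
    refine Finset.sum_congr rfl fun b _ => ?_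
    rw [← Finset.sum_neg_distrib]
    refine Finset.sum_congr rfl fun c _ => ?_
    rw [← Finset.sum_neg_distrib]
    refine Finset.sum_congr rfl fun e _ => ?_
    simp only [hU]
    ring
  have hterm : ∀ a b c e, 0 ≤ w a * w b * w c * w e * (-U a b c e) := fun a b c e =>
    mul_nonneg (mul_nonneg (mul_nonneg (mul_nonneg (hw0 a) (hw0 b)) (hw0 c)) (hw0 e))
      (hU0 a b c e)
  rw [hA, hB]
  calc ∑ a ∈ A, ∑ b ∈ A, ∑ c ∈ A, ∑ e ∈ A, w a * w b * w c * w e * (-U a b c e)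
      ≤ ∑ a ∈ A, ∑ b ∈ A, ∑ c ∈ A, ∑ e ∈ B, w a * w b * w c * w e * (-U a b c e) :=
        Finset.sum_le_sum fun a _ => Finset.sum_le_sum fun b _ => Finset.sum_le_sum fun c _ =>
          Finset.sum_le_sum_of_subset_of_nonneg hAB fun e _ _ => hterm a b c e
    _ ≤ ∑ a ∈ A, ∑ b ∈ A, ∑ c ∈ B, ∑ e ∈ B, w a * w b * w c * w e * (-U a b c e) :=
        Finset.sum_le_sum fun a _ => Finset.sum_le_sum fun b _ =>
          Finset.sum_le_sum_of_subset_of_nonneg hAB fun c _ _ =>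
            Finset.sum_nonneg fun e _ => hterm a b c e
    _ ≤ ∑ a ∈ A, ∑ b ∈ B, ∑ c ∈ B, ∑ e ∈ B, w a * w b * w c * w e * (-U a b c e) :=
        Finset.sum_le_sum fun a _ => Finset.sum_le_sum_of_subset_of_nonneg hAB fun b _ _ =>
          Finset.sum_nonneg fun c _ => Finset.sum_nonneg fun e _ => hterm a b c e
    _ ≤ ∑ a ∈ B, ∑ b ∈ B, ∑ c ∈ B, ∑ e ∈ B, w a * w b * w c * w e * (-U a b c e) :=
        Finset.sum_le_sum_of_subset_of_nonneg hAB fun a _ _ =>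
          Finset.sum_nonneg fun b _ => Finset.sum_nonneg fun c _ =>
            Finset.sum_nonneg fun e _ => hterm a b c e

end Summit.CriticalPhenomena.Ising3DConformalLimit.LeeYangGapSmearedNonGaussianity

end
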